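import Mathlib.InformationTheory.Hamming
import Mathlib.LinearAlgebra.Matrix.Rank
import Mathlib.Data.Real.Basic
import Literature.InformationTheory.Coding.DualDistance
import HarnessLib

/-!
# Tensor product codes: row/column test, robustness, product expansion, identity-word obstruction

For linear codes `C₁ ≤ F^m` (column code) and `C₂ ≤ F^n` (row code) the **tensor product code**
`C₁ ⊗ C₂ ≤ F^{m×n}` is the space of matrices all of whose columns lie in `C₁` and all of whose rows
lie in `C₂` (Ben-Sasson–Sudan 2006 §2; Goldreich–Meir 2012 §1: "`R ⊗ C` consists of all matrices
whose rows are codewords of `R` and whose columns are codewords of `C`"; for linear codes this is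
the span of the rank-one words, Garg–Sudan–Wu 2024 §2). The ROW/COLUMN TEST reads a random row
(column) and measures its Hamming distance to `C₂` (`C₁`); the pair is **robustly testable** when
the distance of every word to `C₁ ⊗ C₂` is controlled by its row- and column-distances
(Ben-Sasson–Sudan 2006; here in un-normalised COUNT form `tensorDefect ≤ K·(rowDefect + colDefect)`,
so the printed `α`-robustness `ρ(M) ≥ α·δ(M)` is `IsRobust … (1/(2α))`). The **dual product code**
`C₁ ⊞ C₂ = C₁ ⊗ F^n + F^m ⊗ C₂` and **product expansion** are Kalachev–Panteleev 2022 §2.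

Proved here (elementary; no named facts):
* `vecMulVec_mem_tensorCode` — rank-one tensors of codewords are tensor codewords;
* `card_le_nonzeroCols_add_nonzeroRows`, `IsProductExpanding.le_inv_card` — the IDENTITY-WORD
  OBSTRUCTION (Kalachev–Panteleev 2022, Remark 2): if the identity matrix lies in `C₁ ⊞ C₂`
  (a CSS pair, `H₁H₂ᵀ = 0`) then every splitting uses at least `n` columns + rows (rank
  sub-additivity), so `ρ`-product-expansion forces `ρ ≤ 1/n`;
* `rank_le_nonzeroCols_add_finrank`, `card_mul_minDist_le_weight` — the rank certificate behind
  Goldreich–Meir's Claim 4.1 (transposed): for `Cm` with rows in `C₂` and `W ∈ C₁ ⊗ C₂`,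
  `rank (X - Cm) ≤ #(nonzero columns of X - W) + dim C₂`, and a word with columns in `C₁` has
  `#(nonzero columns) · minDist C₁ ≤ weight`.

Design: codes are Mathlib `Submodule F (ι → F)`; words are `Matrix m n F`; weights/distances are
Mathlib's `hammingNorm`/`hammingDist` (row-wise, summed); `minDist` is the tree's (`DualDistance`).
NOT here: the span characterisation of `C₁ ⊗ C₂`, the duality `(C₁ ⊞ C₂)^⊥ = C₁^⊥ ⊗ C₂^⊥`, the
(elementary, unprinted) equivalence of robustness with its "columns exactly in `C₁`" restriction
(cell qa-qnc0, Summits side), and robustness THEOREMS for specific families (Reed–Solomon: Polishchuk–Spielman 1994; LDPC / weakly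
smooth: Dinur–Sudan–Wigderson 2006, Ben-Sasson–Viderman 2009; random: Kalachev–Panteleev 2022).

## References
* E. Ben-Sasson, M. Sudan, Random Struct. Algorithms 28 (2006) 387–402, §2 [BensassonSudan2006].
* G. Kalachev, P. Panteleev, arXiv:2206.09973 (2022), §2: Definition (product-expansion), Lemma 1,
  Remark 2 [KalachevPanteleev2022].
* O. Goldreich, O. Meir, IPL 112 (2012) 351–355 (= ECCC TR07-062), §1, §4 Claim 4.1
  [GoldreichMeir2012]; I. Dinur, M. Sudan, A. Wigderson, APPROX-RANDOM 2006 [DinurSudanWigderson2006];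
  E. Ben-Sasson, M. Viderman, Theory Comput. 5 (2009) [BensassonViderman2009]; S. Garg, M. Sudan,
  G. Wu, arXiv:2410.22606 (2024), §2 [GargSudanWu2024].
-/

noncomputable section

namespace Literature.InformationTheory.Coding

open Matrix Finset Module

variable {F : Type*} [Field F] [DecidableEq F]
variable {ι : Type*} [Fintype ι]
variable {m n : Type*} [Fintype m] [Fintype n]

namespace TensorCode

/-! ### Distance of a word to a linear code -/

/-- Hamming distance from a word `v` to the (nonempty) linear code `C`: the least
`hammingDist v c` over `c ∈ C`. [folklore] -/
def distTo (C : Submodule F (ι → F)) (v : ι → F) : ℕ :=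
  sInf {d | ∃ c ∈ C, hammingDist v c = d}

/-- The distance to a code is attained (a minimum, as in the printed definition `δ_C(r)`).
[cite: BensassonSudan2006, §2] -/
theorem exists_hammingDist_eq_distTo (C : Submodule F (ι → F)) (v : ι → F) :
    ∃ c ∈ C, hammingDist v c = distTo C v :=
  Nat.sInf_mem (s := {d | ∃ c ∈ C, hammingDist v c = d}) ⟨hammingDist v 0, 0, C.zero_mem, rfl⟩

/-- `distTo C v ≤ hammingDist v c` for every codeword `c` (unfolding of the printed `δ_C`).
[cite: BensassonSudan2006, §2] -/
theorem distTo_le {C : Submodule F (ι → F)} {v c : ι → F} (hc : c ∈ C) :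
    distTo C v ≤ hammingDist v c :=
  Nat.sInf_le ⟨c, hc, rfl⟩

/-- Codewords are at distance `0`. [cite: BensassonSudan2006, §2] -/
theorem distTo_eq_zero_of_mem {C : Submodule F (ι → F)} {v : ι → F} (hv : v ∈ C) :
    distTo C v = 0 :=
  Nat.le_zero.mp ((distTo_le hv).trans (hammingDist_self v).le)

/-! ### Words as matrices: weight, tensor code, dual product code -/

/-- Hamming weight of a matrix word: the number of nonzero entries, as the sum of the Hamming
weights of its rows. [folklore] -/
def weight (M : Matrix m n F) : ℕ := ∑ i, hammingNorm (M i)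

/-- The weight of a difference is the sum of the row Hamming distances (the printed `δ(M,N)`, un-normalised).
[cite: BensassonSudan2006, §2] -/
theorem weight_sub (M N : Matrix m n F) : weight (M - N) = ∑ i, hammingDist (M i) (N i) := by
  unfold weight
  refine Finset.sum_congr rfl fun i _ => ?_
  rw [hammingDist_comm, hammingDist_eq_hammingNorm, neg_add_eq_sub]
  rfl

/-- The weight of a matrix is also the sum of the Hamming weights of its COLUMNS. [folklore] -/
private theorem weight_eq_sum_cols (M : Matrix m n F) : weight M = ∑ j, hammingNorm (Mᵀ j) := by
  unfold weight hammingNorm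
  simp_rw [Finset.card_eq_sum_ones]
  rw [Finset.sum_comm' (t' := Finset.univ) (s' := fun j => Finset.univ.filter fun i => M i j ≠ 0)]
  · simp
  · intro i j
    simp

/-- Row `i` of a matrix word, as a linear map. [folklore] -/
def rowLin (i : m) : Matrix m n F →ₗ[F] (n → F) where
  toFun M := M i
  map_add' _ _ := rfl
  map_smul' _ _ := rfl

/-- Column `j` of a matrix word, as a linear map. [folklore] -/
def colLin (j : n) : Matrix m n F →ₗ[F] (m → F) where
  toFun M := Mᵀ j
  map_add' _ _ := rfl
  map_smul' _ _ := rfl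

omit [DecidableEq F] [Fintype m] [Fintype n] in
/-- Unfolding of `rowLin`. [folklore] -/
@[simp] private theorem rowLin_apply (i : m) (M : Matrix m n F) : rowLin i M = M i := rfl

omit [DecidableEq F] [Fintype m] [Fintype n] in
/-- Unfolding of `colLin`. [folklore] -/
@[simp] private theorem colLin_apply (j : n) (M : Matrix m n F) : colLin j M = Mᵀ j := rfl

/-- The words all of whose COLUMNS lie in `C₁` (the code `C₁ ⊗ F^n`). [cite: BensassonSudan2006, §2] -/
def colCode (n : Type*) (C₁ : Submodule F (m → F)) : Submodule F (Matrix m n F) :=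
  ⨅ j : n, C₁.comap (colLin j)

/-- The words all of whose ROWS lie in `C₂` (the code `F^m ⊗ C₂`). [cite: BensassonSudan2006, §2] -/
def rowCode (m : Type*) (C₂ : Submodule F (n → F)) : Submodule F (Matrix m n F) :=
  ⨅ i : m, C₂.comap (rowLin i)

omit [DecidableEq F] [Fintype m] [Fintype n] in
/-- Membership in `C₁ ⊗ F^n`: every column is a codeword of `C₁`. [cite: KalachevPanteleev2022, §2] -/
theorem mem_colCode_iff {C₁ : Submodule F (m → F)} {M : Matrix m n F} :
    M ∈ colCode n C₁ ↔ ∀ j, Mᵀ j ∈ C₁ := by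
  simp [colCode, Submodule.mem_iInf]

omit [DecidableEq F] [Fintype m] [Fintype n] in
/-- Membership in `F^m ⊗ C₂`: every row is a codeword of `C₂`. [cite: KalachevPanteleev2022, §2] -/
theorem mem_rowCode_iff {C₂ : Submodule F (n → F)} {M : Matrix m n F} :
    M ∈ rowCode m C₂ ↔ ∀ i, M i ∈ C₂ := by
  simp [rowCode, Submodule.mem_iInf]

/-- The **tensor product code** `C₁ ⊗ C₂`: matrices with all columns in `C₁` and all rows in `C₂`.
[cite: BensassonSudan2006, §2] -/
def tensorCode (C₁ : Submodule F (m → F)) (C₂ : Submodule F (n → F)) :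
    Submodule F (Matrix m n F) :=
  colCode n C₁ ⊓ rowCode m C₂

/-- The **dual product code** `C₁ ⊞ C₂ = C₁ ⊗ F^n + F^m ⊗ C₂` (sums of a word with columns in `C₁`
and a word with rows in `C₂`). [cite: KalachevPanteleev2022, §2] -/
def dualProductCode (C₁ : Submodule F (m → F)) (C₂ : Submodule F (n → F)) :
    Submodule F (Matrix m n F) :=
  colCode n C₁ ⊔ rowCode m C₂

omit [DecidableEq F] [Fintype m] [Fintype n] in
/-- `M ∈ C₁ ⊗ C₂` iff every column of `M` is in `C₁` and every row is in `C₂`.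
[cite: BensassonSudan2006, §2] -/
theorem mem_tensorCode_iff {C₁ : Submodule F (m → F)} {C₂ : Submodule F (n → F)}
    {M : Matrix m n F} : M ∈ tensorCode C₁ C₂ ↔ (∀ j, Mᵀ j ∈ C₁) ∧ ∀ i, M i ∈ C₂ := by
  rw [tensorCode, Submodule.mem_inf, mem_colCode_iff, mem_rowCode_iff]

omit [DecidableEq F] [Fintype m] [Fintype n] in
/-- `E ∈ C₁ ⊞ C₂` iff `E = A + B` with the columns of `A` in `C₁` and the rows of `B` in `C₂`.
[cite: KalachevPanteleev2022, §2] -/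
theorem mem_dualProductCode_iff {C₁ : Submodule F (m → F)} {C₂ : Submodule F (n → F)}
    {E : Matrix m n F} :
    E ∈ dualProductCode C₁ C₂ ↔ ∃ A ∈ colCode n C₁, ∃ B ∈ rowCode m C₂, A + B = E :=
  Submodule.mem_sup

omit [DecidableEq F] [Fintype m] [Fintype n] in
/-- Rank-one tensors of codewords are tensor codewords. [cite: GargSudanWu2024, §2] -/
theorem vecMulVec_mem_tensorCode {C₁ : Submodule F (m → F)} {C₂ : Submodule F (n → F)}
    {a : m → F} {b : n → F} (ha : a ∈ C₁) (hb : b ∈ C₂) :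
    Matrix.vecMulVec a b ∈ tensorCode C₁ C₂ := by
  refine mem_tensorCode_iff.mpr ⟨fun j => ?_, fun i => ?_⟩
  · have : (Matrix.vecMulVec a b)ᵀ j = b j • a := by
      ext i; simp [Matrix.vecMulVec_apply, mul_comm]
    rw [this]; exact C₁.smul_mem _ ha
  · have : Matrix.vecMulVec a b i = a i • b := by
      ext j; simp [Matrix.vecMulVec_apply]
    rw [this]; exact C₂.smul_mem _ hb

/-! ### Row defect, column defect, distance to the tensor code -/

/-- Row defect of a word: the sum over rows of the distance to `C₂` (un-normalised `ρ_row`).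
[cite: BensassonSudan2006, §2] -/
def rowDefect (C₂ : Submodule F (n → F)) (M : Matrix m n F) : ℕ := ∑ i, distTo C₂ (M i)

/-- Column defect of a word: the sum over columns of the distance to `C₁`.
[cite: BensassonSudan2006, §2] -/
def colDefect (C₁ : Submodule F (m → F)) (M : Matrix m n F) : ℕ := ∑ j, distTo C₁ (Mᵀ j)

/-- Distance (weight count) from a word to the tensor code `C₁ ⊗ C₂`. [cite: BensassonSudan2006, §2] -/
def tensorDefect (C₁ : Submodule F (m → F)) (C₂ : Submodule F (n → F)) (M : Matrix m n F) : ℕ :=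
  sInf {w | ∃ N ∈ tensorCode C₁ C₂, weight (M - N) = w}

/-- The distance to the tensor code is attained (a minimum, as printed). [cite: BensassonSudan2006, §2] -/
theorem exists_weight_eq_tensorDefect (C₁ : Submodule F (m → F)) (C₂ : Submodule F (n → F))
    (M : Matrix m n F) : ∃ N ∈ tensorCode C₁ C₂, weight (M - N) = tensorDefect C₁ C₂ M :=
  Nat.sInf_mem (s := {w | ∃ N ∈ tensorCode C₁ C₂, weight (M - N) = w})
    ⟨weight (M - 0), 0, Submodule.zero_mem _, rfl⟩

/-- `tensorDefect M ≤ weight (M - N)` for every tensor codeword `N` (unfolding of the printed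
`δ_{C₁⊗C₂}(M)`). [cite: BensassonSudan2006, §2] -/
theorem tensorDefect_le {C₁ : Submodule F (m → F)} {C₂ : Submodule F (n → F)} {M N : Matrix m n F}
    (hN : N ∈ tensorCode C₁ C₂) : tensorDefect C₁ C₂ M ≤ weight (M - N) :=
  Nat.sInf_le ⟨N, hN, rfl⟩

/-- Words with all rows in `C₂` have row defect `0`. [cite: BensassonSudan2006, §2] -/
theorem rowDefect_eq_zero_of_mem {C₂ : Submodule F (n → F)} {M : Matrix m n F}
    (hM : M ∈ rowCode m C₂) : rowDefect C₂ M = 0 :=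
  Finset.sum_eq_zero fun i _ => distTo_eq_zero_of_mem (mem_rowCode_iff.mp hM i)

/-- Words with all columns in `C₁` have column defect `0`. [cite: BensassonSudan2006, §2] -/
theorem colDefect_eq_zero_of_mem {C₁ : Submodule F (m → F)} {M : Matrix m n F}
    (hM : M ∈ colCode n C₁) : colDefect C₁ M = 0 :=
  Finset.sum_eq_zero fun j _ => distTo_eq_zero_of_mem (mem_colCode_iff.mp hM j)

/-! ### Robustness of the row/column test -/

/-- **Robust testability** of the pair `(C₁, C₂)` with constant `K` (count form of
Ben-Sasson–Sudan's `α`-robustness, `α = 1/(2K)` after normalising by `|m|·|n|`): the distance of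
ANY word to `C₁ ⊗ C₂` is at most `K` times the sum of its row defect and column defect.
[cite: BensassonSudan2006, §2] -/
def IsRobust (C₁ : Submodule F (m → F)) (C₂ : Submodule F (n → F)) (K : ℝ) : Prop :=
  ∀ M : Matrix m n F, (tensorDefect C₁ C₂ M : ℝ) ≤ K * (rowDefect C₂ M + colDefect C₁ M)

/-! ### Product expansion and the identity-word obstruction -/

/-- Number of nonzero columns of a matrix word. [folklore] -/
def nonzeroCols (A : Matrix m n F) : ℕ := #{j | Aᵀ j ≠ 0}

/-- Number of nonzero rows of a matrix word. [folklore] -/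
def nonzeroRows (B : Matrix m n F) : ℕ := #{i | B i ≠ 0}

/-- **Product expansion** (count form of Kalachev–Panteleev's `ρ`-product-expansion; their
normalisation is `‖E‖ = weight E/(|m||n|)`, `‖A‖ = nonzeroCols A/|n|`, `‖B‖ = nonzeroRows B/|m|`):
every word of `C₁ ⊞ C₂` splits as (columns in `C₁`) + (rows in `C₂`) with
`ρ·(|m|·#cols + |n|·#rows) ≤ weight`. [cite: KalachevPanteleev2022, §2 Definition] -/
def IsProductExpanding (C₁ : Submodule F (m → F)) (C₂ : Submodule F (n → F)) (ρ : ℝ) : Prop :=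
  ∀ E ∈ dualProductCode C₁ C₂, ∃ A ∈ colCode n C₁, ∃ B ∈ rowCode m C₂,
    A + B = E ∧
      ρ * (Fintype.card m * (nonzeroCols A : ℝ) + Fintype.card n * (nonzeroRows B : ℝ)) ≤ weight E

/-- The rank of a matrix is at most its number of nonzero columns ("at least `n - k` non-zero rows in
`M - N`", transposed: rank counts at most the nonzero lines). [cite: GoldreichMeir2012, Claim 4.1] -/
theorem rank_le_nonzeroCols [DecidableEq n] (A : Matrix m n F) : A.rank ≤ nonzeroCols A := by
  classical
  set D : Matrix n n F := Matrix.diagonal fun j => if Aᵀ j ≠ 0 then (1 : F) else 0 with hD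
  have hE : A = A * D := by
    ext i j
    rw [hD, Matrix.mul_diagonal]
    by_cases hj : Aᵀ j ≠ 0
    · simp [hj]
    · have h0 : A i j = 0 := by
        have := congrFun (not_ne_iff.mp hj) i
        simpa using this
      simp [hj, h0]
  have hr : A.rank = (A * D).rank := congrArg Matrix.rank hE
  rw [hr]
  refine (Matrix.rank_mul_le_right _ _).trans ?_
  rw [hD, Matrix.rank_diagonal, Fintype.card_subtype]
  unfold nonzeroCols
  refine le_of_eq ?_
  congr 1; ext j; simp

/-- The rank of a matrix is at most its number of nonzero rows ("there are at least `n - k` non-zero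
rows in `M - N`"). [cite: GoldreichMeir2012, Claim 4.1] -/
theorem rank_le_nonzeroRows [DecidableEq m] (B : Matrix m n F) : B.rank ≤ nonzeroRows B := by
  classical
  set D : Matrix m m F := Matrix.diagonal fun i => if B i ≠ 0 then (1 : F) else 0 with hD
  have hE : B = D * B := by
    ext i j
    rw [hD, Matrix.diagonal_mul]
    by_cases hi : B i ≠ 0
    · simp [hi]
    · have h0 : B i j = 0 := by
        have := congrFun (not_ne_iff.mp hi) j
        simpa using this
      simp [hi, h0]
  have hr : B.rank = (D * B).rank := congrArg Matrix.rank hE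
  rw [hr]
  refine (Matrix.rank_mul_le_left _ _).trans ?_
  rw [hD, Matrix.rank_diagonal, Fintype.card_subtype]
  unfold nonzeroRows
  refine le_of_eq ?_
  congr 1; ext i; simp

omit [DecidableEq F] [Fintype m] in
/-- Sub-additivity of matrix rank over a field. [folklore] -/
private theorem rank_add_le_rank_add (A B : Matrix m n F) : (A + B).rank ≤ A.rank + B.rank := by
  unfold Matrix.rank
  rw [Matrix.mulVecLin_add]
  exact (Submodule.finrank_mono (LinearMap.range_add_le _ _)).trans
    (Submodule.finrank_add_le_finrank_add_finrank _ _)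

/-- **The identity word needs `n` lines.** If `A + B = 1` (square matrices) then
`#(nonzero columns of A) + #(nonzero rows of B) ≥ n` — rank sub-additivity and `rank 1 = n`.
[cite: KalachevPanteleev2022, Remark 2] -/
theorem card_le_nonzeroCols_add_nonzeroRows [DecidableEq n] {A B : Matrix n n F} (h : A + B = 1) :
    Fintype.card n ≤ nonzeroCols A + nonzeroRows B := by
  have h1 : (1 : Matrix n n F).rank = Fintype.card n := Matrix.rank_one
  rw [← h1, ← h]
  exact (rank_add_le_rank_add A B).trans
    (Nat.add_le_add (rank_le_nonzeroCols A) (rank_le_nonzeroRows B))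

/-- The identity word has weight `n`. [folklore] -/
private theorem weight_one [DecidableEq n] : weight (1 : Matrix n n F) = Fintype.card n := by
  unfold weight hammingNorm
  have : ∀ i : n, #{j | (1 : Matrix n n F) i j ≠ 0} = 1 := by
    intro i
    rw [Finset.card_eq_one]
    refine ⟨i, ?_⟩
    ext j
    by_cases hij : i = j
    · subst hij; simp
    · simp [Matrix.one_apply, hij, Ne.symm hij]
  simp [this]

/-- **Identity-word obstruction** (Kalachev–Panteleev 2022, Remark 2): if the identity matrix is a
word of `C₁ ⊞ C₂` — equivalently the pair is CSS, `H₁H₂ᵀ = 0`; in particular `(C, C^⊥)` for every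
`C` — then `(C₁, C₂)` is `ρ`-product-expanding only for `ρ ≤ 1/n`. [cite: KalachevPanteleev2022, Remark 2] -/
theorem IsProductExpanding.le_inv_card [DecidableEq n] [Nonempty n] {C₁ C₂ : Submodule F (n → F)}
    {ρ : ℝ} (hρ : IsProductExpanding C₁ C₂ ρ) (h1 : (1 : Matrix n n F) ∈ dualProductCode C₁ C₂) :
    ρ ≤ 1 / Fintype.card n := by
  obtain ⟨A, _, B, _, hAB, hle⟩ := hρ 1 h1
  have hN : (0 : ℝ) < Fintype.card n := by exact_mod_cast Fintype.card_pos
  rw [weight_one] at hle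
  have hc : (Fintype.card n : ℝ) ≤ nonzeroCols A + nonzeroRows B := by
    exact_mod_cast card_le_nonzeroCols_add_nonzeroRows hAB
  rw [le_div_iff₀ hN]
  rcases le_or_gt ρ 0 with hρ0 | hρ0
  · nlinarith
  · have hstep : ρ * (Fintype.card n * (Fintype.card n : ℝ)) ≤
        ρ * (Fintype.card n * (nonzeroCols A : ℝ) + Fintype.card n * (nonzeroRows B : ℝ)) := by
      have : Fintype.card n * (Fintype.card n : ℝ) ≤
          Fintype.card n * (nonzeroCols A : ℝ) + Fintype.card n * (nonzeroRows B : ℝ) := by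
        nlinarith
      exact mul_le_mul_of_nonneg_left this hρ0.le
    nlinarith

/-! ### The rank certificate (Goldreich–Meir's Claim 4.1, transposed) -/

omit [DecidableEq F] in
/-- A word all of whose rows lie in `C₂` has rank at most `dim C₂` (the step "each column of
`M - I - N` is a codeword of `C`, so the rank … is at most `k`", transposed). [cite: GoldreichMeir2012, Claim 4.1] -/
theorem rank_le_finrank_of_mem_rowCode {C₂ : Submodule F (n → F)} {B : Matrix m n F}
    (hB : B ∈ rowCode m C₂) : B.rank ≤ finrank F C₂ := by
  rw [Matrix.rank_eq_finrank_span_row]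
  exact Submodule.finrank_mono
    (Submodule.span_le.mpr (Set.range_subset_iff.mpr (mem_rowCode_iff.mp hB)))

/-- **Rank certificate.** If `Cm` has all rows in `C₂` and `W ∈ C₁ ⊗ C₂`, then for every `X`,
`rank (X - Cm) ≤ #(nonzero columns of X - W) + dim C₂` (because `(X - Cm) - (X - W) = W - Cm` has
rows in `C₂`). With `card_mul_minDist_le_weight` this is the mechanism of Goldreich–Meir's
non-robust pair (there with rows and columns exchanged). [cite: GoldreichMeir2012, Claim 4.1] -/
theorem rank_le_nonzeroCols_add_finrank [DecidableEq n] {C₁ : Submodule F (m → F)}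
    {C₂ : Submodule F (n → F)} {X Cm W : Matrix m n F} (hCm : Cm ∈ rowCode m C₂)
    (hW : W ∈ tensorCode C₁ C₂) :
    (X - Cm).rank ≤ nonzeroCols (X - W) + finrank F C₂ := by
  have hsplit : X - Cm = (X - W) + (W - Cm) := by abel
  have hWC : W - Cm ∈ rowCode m C₂ :=
    Submodule.sub_mem _ ((Submodule.mem_inf.mp hW).2) hCm
  rw [hsplit]
  exact (rank_add_le_rank_add _ _).trans
    (Nat.add_le_add (rank_le_nonzeroCols _) (rank_le_finrank_of_mem_rowCode hWC))

/-- Every nonzero column of a word with columns in `C₁` weighs at least `minDist C₁`, so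
`#(nonzero columns) · minDist C₁ ≤ weight` (the step "non-zero rows in `M - N`, each of which is a
codeword of `R`", transposed). [cite: GoldreichMeir2012, Claim 4.1] -/
theorem card_mul_minDist_le_weight {C₁ : Submodule F (m → F)} {D : Matrix m n F}
    (hD : D ∈ colCode n C₁) :
    (nonzeroCols D : ℕ∞) * minDist C₁ ≤ weight D := by
  rw [weight_eq_sum_cols, Nat.cast_sum]
  have hcols := mem_colCode_iff.mp hD
  calc (nonzeroCols D : ℕ∞) * minDist C₁
      = ∑ j ∈ Finset.univ.filter (fun j => Dᵀ j ≠ 0), minDist C₁ := by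
        rw [Finset.sum_const, nsmul_eq_mul]; rfl
    _ ≤ ∑ j ∈ Finset.univ.filter (fun j => Dᵀ j ≠ 0), (hammingNorm (Dᵀ j) : ℕ∞) :=
        Finset.sum_le_sum fun j hj => minDist_le_hammingNorm (hcols j) (Finset.mem_filter.mp hj).2
    _ ≤ ∑ j, (hammingNorm (Dᵀ j) : ℕ∞) :=
        Finset.sum_le_sum_of_subset_of_nonneg (Finset.filter_subset _ _) fun _ _ _ => by simp

end TensorCode

end Literature.InformationTheory.Coding
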